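import Literature.AlgebraicGeometry.Morphisms.StalkOfDualNumberRigid
import HarnessLib

/-!
# `ℂ[ε]`-points lift along `p` at `x` ⇒ the cotangent map of `p` at `x` is injective ⇒ `dim 𝔪_{p x}/𝔪_{p x}² ≤ dim 𝔪_x/𝔪_x²`
# (Görtz–Wedhorn I (6.4), Def. 6.2 / Prop. 6.7: `T_x X = X(k[ε])_x = (𝔪_x/𝔪_x²)^∨`, functorially)

Topic `Literature/AlgebraicGeometry/Morphisms`, namespace `Literature.AlgebraicGeometry.Morphisms`.  THEOREMS ONLY
(no definition, no named fact, no instance, no `sorry`).  Generic, consumer-agnostic companion of ★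
`Morphisms/StalkOfDualNumberRigid` (which reads «no non-constant `ℂ[ε]`-points in the fibres» as UNRAMIFIEDNESS); here
the dual reading: «`ℂ[ε]`-points of the TARGET lift» gives SURJECTIVITY of the tangent map, i.e. INJECTIVITY of the
cotangent map, hence the inequality of Zariski cotangent dimensions at the point.  In the cell `hodgecm-mathlib` (D-0151)
this is road (R4) «infinitesimal» for the Hecke-link line of SOCKETS-F §4 (α): relative dimension LIFTS along the level
maps `tr : 𝓐_{g,δ,N′} → 𝓐_{g,δ,N}` at every `ℂ`-point (the moduli input — `tr` lifts `ℂ[ε]`-points, by the unique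
infinitesimal lifting of level structures ★ `LevelStructureLiftNilpotent` — is supplied by its consumer).
HC_CM is proved only modulo the 7 printed citations until rung 0 closes.  (Ed. 2: the consumers are the (R4-δ) files
`Morphisms/RelDimOfDualNumberLifts` and `ModuliOfAbelianVarieties/SiegelModuliTowerLiftsRelDim`, together with ★ `Dimension/CotangentDimensionOfOpenPiece`.)

**§1 (commutative algebra).**  Let `φ : (A, π_A) → (B, π_B)` be a map of augmented `k`-algebras (`π_B ∘ φ = π_A`).  If every
tangent vector `g : A → k[ε]` of `(A, π_A)` (★ `RingTheory/CompleteLocalRings/DualNumberPoints :: TangentHom`) factors as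
`g = g′ ∘ φ` through a tangent vector `g′` of `(B, π_B)`, then Mathlib's cotangent map
`Ideal.mapCotangent (ker π_A) (ker π_B) φ : 𝔪_A/𝔪_A² → 𝔪_B/𝔪_B²` is INJECTIVE: a class `v` in its kernel is killed by every
linear form `ℓ` on `𝔪_A/𝔪_A²`, because `ℓ` is the `ε`-part of `g_ℓ = ofDual ℓ` (★ `TangentHom.ofDual`), `g_ℓ = g′ ∘ φ`, and the
`ε`-part of `g′` is a linear form on `𝔪_B/𝔪_B²` (★ `TangentHom.toDual`) evaluated at the image `0` of `v`; so `v = 0`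
(Mathlib `Module.forall_dual_apply_eq_zero_iff`).  Hence `dim_k 𝔪_A/𝔪_A² ≤ dim_k 𝔪_B/𝔪_B²` for `B` Noetherian, and — for LOCAL
Noetherian `A`, `B` — the same inequality for `Module.finrank (ResidueField ·) (CotangentSpace ·)` (★
`TangentHom.finrank_cotangentSpace_eq_spanFinrank`, Mathlib `IsLocalRing.spanFinrank_maximalIdeal_eq_finrank_cotangentSpace`).

**§2 (schemes).**  For a `ℂ`-morphism `p : X ⟶ Y` of `ℂ`-schemes with `Y` and `p` locally of finite type and a closed point
`x` of `X`: if every `ℂ`-morphism `τ : Spec ℂ[ε] → Y` centred at `p x` lifts to a `ℂ`-morphism `σ : Spec ℂ[ε] → X` centred at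
`x` with `σ ≫ p = τ`, then `dim_{κ(p x)} 𝔪_{p x}/𝔪_{p x}² ≤ dim_{κ(x)} 𝔪_x/𝔪_x²` (`finrank_cotangentSpace_le_of_dualNumber_lifts`).
Assembly verbatim along ★ `StalkOfDualNumberRigid` §1–§2: the `ℂ`-algebra structures `ℂ → 𝒪_{X,x}`, `ℂ → 𝒪_{Y,p x}`
(`strMap`), the augmentations at the closed points (Mathlib `residueFieldIsoBase`), the tangent vector `g` of `𝒪_{Y,p x}`
as the `ℂ[ε]`-point `Spec ℂ[ε] → Spec 𝒪_{Y,p x} → Y` (`specPtAt`), the local homomorphism `g′ = locHomAt σ` of the lift,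
and `g = g′ ∘ p^♯` from `Spec g′ ≫ Spec p^♯_x ≫ (Spec 𝒪_{Y,p x} → Y) = σ ≫ p = τ` (Mathlib `Scheme.SpecMap_stalkMap_fromSpecStalk`
and the left inverse `locHomAt_specPtAt`).

## References
* [GortzWedhorn2020] U. Görtz, T. Wedhorn, *Algebraic Geometry I* (2nd ed. 2020), (6.3)–(6.4): Def. 6.2 (Zariski tangent space
  `T_x X = (𝔪_x/𝔪_x²)^*`), Prop. 6.7 / Exercise 6.6 (`T_x X = X(k[ε])_x`; the tangent map `df_x : T_x X → T_{f x} Y` is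
  `X(k[ε])_x → Y(k[ε])_{f x}` and is dual to `𝔪_{f x}/𝔪_{f x}² → 𝔪_x/𝔪_x²`), Exercise 3.18, Cor. 3.36.
* [Mazur1997Deformation] B. Mazur, *An introduction to the deformation theory of Galois representations* (1997), §15.
* [StacksProject] The Stacks Project, Tag 0B2C (tangent spaces, 0B2E: functoriality), Tag 00DV.
-/

set_option autoImplicit false

noncomputable section

universe u

open CategoryTheory CategoryTheory.Limits AlgebraicGeometry TopologicalSpace IsLocalRing

namespace Literature.AlgebraicGeometry.Morphisms

/-! ### §1 Commutative algebra: tangent vectors of `(A, π_A)` lift through `φ` ⇒ the cotangent map of `φ` is injective -/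

section Core

open TrivSqZeroExt Literature.RingTheory.CompleteLocalRings

variable {k : Type u} [Field k] {A B : Type u} [CommRing A] [CommRing B] [Algebra k A] [Algebra k B]
  (πA : A →ₐ[k] k) (πB : B →ₐ[k] k) (φ : A →ₐ[k] B)

/-- A map of augmented algebras sends the augmentation ideal into the augmentation ideal. [cite: GortzWedhorn2020, (6.4)] -/
theorem ker_le_comap_ker (hφ : ∀ a, πB (φ a) = πA a) : RingHom.ker πA ≤ (RingHom.ker πB).comap φ := by
  intro a ha
  rw [RingHom.mem_ker] at ha
  rw [Ideal.mem_comap, RingHom.mem_ker, hφ, ha]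

/-- **Tangent vectors lift ⇒ the cotangent map is injective** (the dual of «`dφ` surjective on tangent spaces»): if every
`g ∈ t_{(A,π_A)}` factors as `g′ ∘ φ` with `g′ ∈ t_{(B,π_B)}`, then `𝔪_A/𝔪_A² → 𝔪_B/𝔪_B²` is injective.
[cite: GortzWedhorn2020, (6.4) Prop. 6.7 and Def. 6.2] [cite: Mazur1997Deformation, §15] -/
theorem mapCotangent_injective_of_tangentHom_lift (hφ : ∀ a, πB (φ a) = πA a)
    (H : ∀ g : TangentHom πA, ∃ g' : TangentHom πB, ∀ a, g'.1 (φ a) = g.1 a) :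
    Function.Injective (Ideal.mapCotangent (RingHom.ker πA) (RingHom.ker πB) φ (ker_le_comap_ker πA πB φ hφ)) := by
  rw [injective_iff_map_eq_zero]
  intro v hv
  refine (Module.forall_dual_apply_eq_zero_iff k v).1 fun ℓ => ?_
  obtain ⟨x, rfl⟩ := (RingHom.ker πA).toCotangent_surjective v
  obtain ⟨g', hg'⟩ := H (TangentHom.ofDual ℓ)
  have h1 : ℓ ((RingHom.ker πA).toCotangent x) = ((TangentHom.ofDual ℓ).1 (x : A)).snd := by
    rw [TangentHom.ofDual_apply, snd_add, snd_inl, snd_inr, zero_add, TangentHom.proj_of_mem]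
  have hx' : φ x ∈ RingHom.ker πB := ker_le_comap_ker πA πB φ hφ x.2
  have h2 : (g'.1 (φ x)).snd = g'.toDual ((RingHom.ker πB).toCotangent ⟨φ x, hx'⟩) :=
    (TangentHom.toDual_toCotangent g' ⟨φ x, hx'⟩).symm
  rw [h1, ← hg' x, h2, ← Ideal.mapCotangent_toCotangent (RingHom.ker πA) (RingHom.ker πB) φ
      (ker_le_comap_ker πA πB φ hφ) x, hv, map_zero]

/-- **`dim_k 𝔪_A/𝔪_A² ≤ dim_k 𝔪_B/𝔪_B²`** when tangent vectors lift through `φ` and `B` is Noetherian.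
[cite: GortzWedhorn2020, (6.4) Prop. 6.7 and Def. 6.2] -/
theorem finrank_cotangent_le_of_tangentHom_lift [IsNoetherianRing B] (hφ : ∀ a, πB (φ a) = πA a)
    (H : ∀ g : TangentHom πA, ∃ g' : TangentHom πB, ∀ a, g'.1 (φ a) = g.1 a) :
    Module.finrank k (RingHom.ker πA).Cotangent ≤ Module.finrank k (RingHom.ker πB).Cotangent := by
  haveI := TangentHom.finite_cotangent (π := πB)
  exact LinearMap.finrank_le_finrank_of_injective (mapCotangent_injective_of_tangentHom_lift πA πB φ hφ H)

/-- For a LOCAL Noetherian augmented `k`-algebra, `dim_{κ} 𝔪/𝔪² = dim_k (ker π)/(ker π)²` (`κ = k`, `ker π = 𝔪`).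
[cite: Mazur1997Deformation, §15] -/
theorem finrank_residueField_cotangentSpace_eq_finrank_ker_cotangent [IsLocalRing A] [IsNoetherianRing A] :
    Module.finrank (ResidueField A) (CotangentSpace A) = Module.finrank k (RingHom.ker πA).Cotangent := by
  rw [← IsLocalRing.spanFinrank_maximalIdeal_eq_finrank_cotangentSpace,
    ← TangentHom.finrank_cotangentSpace_eq_spanFinrank πA]
  exact (((Ideal.Cotangent.equivOfEq _ _ (TangentHom.ker_eq_maximalIdeal πA)).restrictScalars k).finrank_eq).symm

/-- **Local form**: for local Noetherian augmented `k`-algebras, tangent vectors lifting through the (augmentation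
compatible) map `φ` force `dim_{κ(A)} 𝔪_A/𝔪_A² ≤ dim_{κ(B)} 𝔪_B/𝔪_B²`. [cite: GortzWedhorn2020, (6.4) Prop. 6.7 and Def. 6.2] -/
theorem finrank_cotangentSpace_le_of_tangentHom_lift [IsLocalRing A] [IsLocalRing B] [IsNoetherianRing A]
    [IsNoetherianRing B] (hφ : ∀ a, πB (φ a) = πA a)
    (H : ∀ g : TangentHom πA, ∃ g' : TangentHom πB, ∀ a, g'.1 (φ a) = g.1 a) :
    Module.finrank (ResidueField A) (CotangentSpace A) ≤ Module.finrank (ResidueField B) (CotangentSpace B) := by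
  rw [finrank_residueField_cotangentSpace_eq_finrank_ker_cotangent πA,
    finrank_residueField_cotangentSpace_eq_finrank_ker_cotangent πB]
  exact finrank_cotangent_le_of_tangentHom_lift πA πB φ hφ H

end Core

/-! ### §2 Schemes: `ℂ[ε]`-points of `Y` centred at `p x` lift to `X` centred at `x` ⇒ `dim 𝔪_{p x}/𝔪_{p x}² ≤ dim 𝔪_x/𝔪_x²` -/

section DualNumberLifts

open TrivSqZeroExt DualNumber Literature.RingTheory.CompleteLocalRings Literature.AlgebraicGeometry.Motives

/-- **`ℂ[ε]`-points lift along `p` at `x` ⇒ `dim_{κ(p x)} 𝔪_{p x}/𝔪_{p x}² ≤ dim_{κ(x)} 𝔪_x/𝔪_x²`.**  For a `ℂ`-morphism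
`p : X ⟶ Y` with `Y` and `p` locally of finite type and a closed point `x` of `X`: if every `ℂ`-morphism
`τ : Spec ℂ[ε] → Y` centred at `p x` is `σ ≫ p` for a `ℂ`-morphism `σ : Spec ℂ[ε] → X` centred at `x`, the cotangent map at
`x` is injective (`§1` for `p^♯_x : 𝒪_{Y,p x} → 𝒪_{X,x}` with the structure maps and augmentations of ★
`StalkOfDualNumberRigid` §2; a tangent vector `g` of `𝒪_{Y,p x}` is the `ℂ[ε]`-point `Spec ℂ[ε] → Spec 𝒪_{Y,p x} → Y`, its lift
`σ` has local homomorphism `g′` with `Spec g′ ≫ (Spec 𝒪_{X,x} → X) = σ`, and `g = g′ ∘ p^♯_x` because both define `τ`).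
[cite: GortzWedhorn2020, (6.4) Prop. 6.7, Def. 6.2 and Exercise 3.18] [cite: StacksProject, Tag 0B2C] -/
theorem finrank_cotangentSpace_le_of_dualNumber_lifts {X Y : SchemeOver ℂ} (p : X ⟶ Y)
    [LocallyOfFiniteType Y.hom] [LocallyOfFiniteType p.left]
    (x : X.left) (hx : IsClosed ({x} : Set X.left))
    (h : ∀ τ : specOver ℂ ℂ[ε] ⟶ Y, τ.left.base (closedPoint ℂ[ε]) = p.left.base x →
      ∃ σ : specOver ℂ ℂ[ε] ⟶ X, σ.left.base (closedPoint ℂ[ε]) = x ∧ σ ≫ p = τ) :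
    Module.finrank (ResidueField (Y.left.presheaf.stalk (p.left.base x)))
        (CotangentSpace (Y.left.presheaf.stalk (p.left.base x))) ≤
      Module.finrank (ResidueField (X.left.presheaf.stalk x)) (CotangentSpace (X.left.presheaf.stalk x)) := by
  have hX : X.hom = p.left ≫ Y.hom := (Over.w p).symm
  haveI : LocallyOfFiniteType X.hom := by rw [hX]; infer_instance
  haveI : IsLocallyNoetherian X.left := LocallyOfFiniteType.isLocallyNoetherian X.hom
  haveI : IsLocallyNoetherian Y.left := LocallyOfFiniteType.isLocallyNoetherian Y.hom
  -- `p x` is a closed point of `Y` (it underlies the `ℂ`-point `Spec ℂ → X → Y`)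
  have hyc : IsClosed ({p.left.base x} : Set Y.left) := by
    have hq : (pointOfClosedPoint X.hom x hx ≫ p.left) ≫ Y.hom = 𝟙 _ := by
      rw [Category.assoc, ← hX, pointOfClosedPoint_comp]
    have := (pointEquivClosedPoint Y.hom ⟨pointOfClosedPoint X.hom x hx ≫ p.left, hq⟩).2
    simpa only [pointEquivClosedPoint_apply_coe, Scheme.Hom.comp_apply, pointOfClosedPoint_apply,
      mem_closedPoints_iff] using this
  -- the structure maps `ℂ → 𝒪_{X,x}`, `ℂ → 𝒪_{Y,p x}` and the augmentations
  set sX : CommRingCat.of ℂ ⟶ X.left.presheaf.stalk x :=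
    ((Scheme.ΓSpecIso (.of ℂ)).inv ≫ (Spec (.of ℂ)).presheaf.germ ⊤ (X.hom.base x) trivial) ≫
      X.hom.stalkMap x with hsX
  set sY : CommRingCat.of ℂ ⟶ Y.left.presheaf.stalk (p.left.base x) :=
    ((Scheme.ΓSpecIso (.of ℂ)).inv ≫ (Spec (.of ℂ)).presheaf.germ ⊤ (Y.hom.base (p.left.base x)) trivial) ≫
      Y.hom.stalkMap (p.left.base x) with hsY
  set augX : X.left.presheaf.stalk x ⟶ CommRingCat.of ℂ :=
    X.left.residue x ≫ (residueFieldIsoBase X.hom x hx).hom with haugX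
  set augY : Y.left.presheaf.stalk (p.left.base x) ⟶ CommRingCat.of ℂ :=
    Y.left.residue (p.left.base x) ≫ (residueFieldIsoBase Y.hom (p.left.base x) hyc).hom with haugY
  letI algB : Algebra ℂ (X.left.presheaf.stalk x) := sX.hom.toAlgebra
  letI algA : Algebra ℂ (Y.left.presheaf.stalk (p.left.base x)) := sY.hom.toAlgebra
  have hsφ : sY ≫ p.left.stalkMap x = sX := by
    rw [hsY, hsX, hX]
    exact (strMap_comp p.left Y.hom x).symm
  have hsφ' : ∀ c, (p.left.stalkMap x).hom (sY.hom c) = sX.hom c := fun c => by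
    rw [← RingHom.comp_apply, ← CommRingCat.hom_comp, hsφ]
  let πB : X.left.presheaf.stalk x →ₐ[ℂ] ℂ :=
    { augX.hom with commutes' := fun c => augAt_strMap X.hom x hx c }
  let πA : Y.left.presheaf.stalk (p.left.base x) →ₐ[ℂ] ℂ :=
    { augY.hom with commutes' := fun c => augAt_strMap Y.hom (p.left.base x) hyc c }
  have hπB : ∀ b, πB b = augX b := fun b => rfl
  have hπA : ∀ a, πA a = augY a := fun a => rfl
  let φ : Y.left.presheaf.stalk (p.left.base x) →ₐ[ℂ] X.left.presheaf.stalk x :=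
    { (p.left.stalkMap x).hom with commutes' := fun c => hsφ' c }
  have hφ : ∀ a, φ a = (p.left.stalkMap x).hom a := fun a => rfl
  -- `φ` is compatible with the augmentations (`𝒪_{Y,p x} = ℂ + 𝔪_{p x}`, `φ` local)
  have hφπ : ∀ a, πB (φ a) = πA a := by
    intro a
    set a' := a - sY (augY a) with ha'def
    have ha' : a' ∈ maximalIdeal _ := sub_strMap_augAt_mem Y.hom (p.left.base x) hyc a
    have hφa' : (p.left.stalkMap x).hom a' ∈ maximalIdeal _ :=
      IsLocalRing.map_maximalIdeal_le (p.left.stalkMap x).hom (Ideal.mem_map_of_mem _ ha')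
    have hadec : a = sY.hom (augY.hom a) + a' := by rw [ha'def]; exact (add_sub_cancel _ _).symm
    rw [hπB, hπA, hφ]
    conv_lhs => rw [hadec]
    rw [map_add, hsφ', map_add, augAt_strMap X.hom x hx, augAt_eq_zero_of_mem X.hom x hx hφa', add_zero]
  refine finrank_cotangentSpace_le_of_tangentHom_lift πA πB φ hφπ ?_
  intro g
  -- the `ℂ[ε]`-point `τ` of `Y` through `p x` defined by the tangent vector `g`
  set gR : Y.left.presheaf.stalk (p.left.base x) ⟶ CommRingCat.of ℂ[ε] := CommRingCat.ofHom g.1.toRingHom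
    with hgRdef
  have hgR : ∀ a, gR a = g.1 a := fun a => rfl
  haveI : IsLocalHom gR.hom := ⟨fun a ha => by
    rw [hgR, isUnit_iff_isUnit_fst, g.2 a] at ha
    by_contra hnu
    exact ha.ne_zero (by rw [hπA]; exact augAt_eq_zero_of_mem Y.hom (p.left.base x) hyc hnu)⟩
  haveI : IsLocalHom (CommRingCat.ofHom (algebraMap ℂ ℂ[ε])).hom := isLocalHom_algebraMap_dualNumber
  have hτw : (Spec.map gR ≫ Y.left.fromSpecStalk (p.left.base x)) ≫ Y.hom =
      Spec.map (CommRingCat.ofHom (algebraMap ℂ ℂ[ε])) := by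
    rw [Category.assoc, ← Spec_map_strMap, ← Spec.map_comp]
    congr 1
    apply CommRingCat.hom_ext
    refine RingHom.ext fun c => ?_
    rw [hgRdef]
    change g.1 (algebraMap ℂ _ c) = algebraMap ℂ ℂ[ε] c
    exact g.1.commutes c
  let τ : specOver ℂ ℂ[ε] ⟶ Y := Over.homMk (Spec.map gR ≫ Y.left.fromSpecStalk (p.left.base x)) hτw
  have hτl : τ.left = Spec.map gR ≫ Y.left.fromSpecStalk (p.left.base x) := rfl
  have hτy : τ.left.base (closedPoint ℂ[ε]) = p.left.base x := by
    rw [hτl]; exact specPtAt_closedPoint gR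
  -- the lift `σ` and its local homomorphism `g′`
  obtain ⟨σ, hσx, hσp⟩ := h τ hτy
  set g'R : X.left.presheaf.stalk x ⟶ CommRingCat.of ℂ[ε] :=
    (X.left.presheaf.stalkCongr (.of_eq hσx)).inv ≫ Scheme.stalkClosedPointTo σ.left with hg'Rdef
  haveI : IsLocalHom g'R.hom := isLocalHom_locHomAt σ.left hσx
  have hσspec : Spec.map g'R ≫ X.left.fromSpecStalk x = σ.left := specPtAt_locHomAt σ.left hσx
  -- `g = g′ ∘ p^♯_x`: both local homomorphisms define the point `τ`
  have hcomp : Spec.map (p.left.stalkMap x ≫ g'R) ≫ Y.left.fromSpecStalk (p.left.base x) = τ.left := by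
    rw [Spec.map_comp, Category.assoc, Scheme.SpecMap_stalkMap_fromSpecStalk, ← Category.assoc, hσspec, ← hσp]
    rfl
  haveI : IsLocalHom (p.left.stalkMap x ≫ g'R).hom := by
    rw [CommRingCat.hom_comp]; infer_instance
  have hτy' : (Spec.map (p.left.stalkMap x ≫ g'R) ≫ Y.left.fromSpecStalk (p.left.base x)).base (closedPoint ℂ[ε]) =
      p.left.base x := specPtAt_closedPoint _
  have key : gR = p.left.stalkMap x ≫ g'R := by
    rw [← locHomAt_specPtAt gR (hτl ▸ hτy), locHomAt_congr (hτl.symm.trans hcomp.symm) (hτl ▸ hτy) hτy']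
    exact locHomAt_specPtAt _ hτy'
  -- `g′` is a `ℂ`-algebra map lifting the augmentation of `𝒪_{X,x}`
  have hsg' : sX ≫ g'R = CommRingCat.ofHom (algebraMap ℂ ℂ[ε]) := by
    apply Spec.map_injective
    rw [Spec.map_comp, hsX, Spec_map_strMap, ← Category.assoc, hσspec]
    exact Over.w σ
  have hsg'' : ∀ c, g'R.hom (sX.hom c) = algebraMap ℂ ℂ[ε] c := fun c => by
    rw [← RingHom.comp_apply, ← CommRingCat.hom_comp, hsg']; rfl
  let g' : X.left.presheaf.stalk x →ₐ[ℂ] ℂ[ε] := { g'R.hom with commutes' := fun c => hsg'' c }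
  have hg'v : ∀ b, g' b = g'R.hom b := fun b => rfl
  have hg'fst : ∀ b, (g' b).fst = πB b := by
    intro b
    set b' := b - sX (augX b) with hb'def
    have hb' : b' ∈ maximalIdeal _ := sub_strMap_augAt_mem X.hom x hx b
    have hbdec : b = sX.hom (augX.hom b) + b' := by rw [hb'def]; exact (add_sub_cancel _ _).symm
    have hfst' : (g'R.hom b').fst = 0 := by
      by_contra hne
      have hu : IsUnit (g'R.hom b') := by
        rw [isUnit_iff_isUnit_fst]; exact isUnit_iff_ne_zero.mpr hne
      exact hb' (isUnit_of_map_unit g'R.hom b' hu)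
    rw [hg'v, hπB]
    conv_lhs => rw [hbdec]
    rw [map_add, fst_add, hsg'', algebraMap_eq_inl, fst_inl, hfst', add_zero]
  refine ⟨⟨g', hg'fst⟩, fun a => ?_⟩
  have hk := congrArg (fun f : Y.left.presheaf.stalk (p.left.base x) ⟶ CommRingCat.of ℂ[ε] => f.hom a) key
  simp only [CommRingCat.hom_comp, RingHom.comp_apply] at hk
  exact hk.symm

end DualNumberLifts

end Literature.AlgebraicGeometry.Morphisms

end
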